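import Summits.Schanuel.Schanuel.Theorems.DiophantineDichotomyApproximationPropertyRelativeBox
import Summits.Schanuel.Schanuel.Theorems.DiophantineDichotomyApproximationPropertyDescentCut
import Summits.Schanuel.Schanuel.Theorems.DiophantineDichotomyApproximationPropertyCycleAPITwoLemmas
import Literature.NumberTheory.Transcendental.PhilipponCriterionPrincipal
import Literature.NumberTheory.Transcendental.PhilipponCriterionHomogenization
import HarnessLib

/-!
# Stub `smallPrimeCurve3_of` of line `orbit-interpolation-determinant`: a small prime space curve (crux `ApproximationProperty`, stmt-Schanuel-6117)

Route `DiophantineDichotomy` (sub-problem `Schanuel/Schanuel`), crux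
`Summit.Schanuel.Schanuel.Theses.DiophantineDichotomy.ApproximationProperty` (stmt-Schanuel-6117), line
`orbit-interpolation-determinant`, registered stub `smallPrimeCurve3_of`: **cuts 1–2 of the clause-free
`t = 3` descent** (Philippon's AP1 in `ℙ³`) at `ω̄ = (1 : ω) ∈ ℂ⁴`. The hypothesis H1 is the registered
statement of the neighbouring stub `small_prime_hypersurface` (a small prime HYPERSURFACE `(Q)` in every
`ℙᵐ`), used at `m = 3`: `deg Q = a ≤ Δ`, `h((Q)) ≤ 19 Y`,
`log |(Q)(ω̄)| ≤ −(Δ²/c₁)(Δ (h((Q)) + a) + Y a) =: −S₁`. The conclusion is a small prime SPACE CURVE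
`𝔮 ⊇ (Q, P)` of rank `2`, with `deg 𝔮 ≤ 2Δ²`, `h(𝔮) ≤ c Δ Y`, `log |𝔮(ω̄)| ≤ −(Δ/c)(Δ h(𝔮) + Y deg 𝔮)`.

Proof (the `t = 2` template is the landed stub F, `…CycleAPITwo.lean`):
* CUT 2, the second small form: `b = 2⌊Δ⌋`, so that `binom(b+3,3) − binom(b−a+3,3) ≥ aΔ²/2 + 4`
  monomials of degree `b` survive modulo `(Q)` (`SmallPrimeCurve3.count_bound`); the box principle modulo
  the surface (`RelativeBox.boxModHypersurface_exp`, `m = 3`) with the ADAPTIVE height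
  `h₂ = 16 (Y + Δ h((Q))/a)`, `N = ⌊e^{h₂}⌋`, gives `P ∉ (Q)` of degree `b`, `h(P) ≤ h₂`,
  `log ‖P‖_ω̄ ≤ c_B b − (aΔ²/4) h₂ ≤ −S₁ − (cost of the cut)` (`arith_box`, `arith_E`).
* THE CUT: `small_prime_of_cut` (`…DescentCut.lean`: LNM 1752 Ch. 3 Prop. 4.11, then Prop. 4.7 with the
  weighted choice of a prime component, weights `Δ, Y`), `m = r = 3`, `U = S₁/2 ≥ 54ab`: a homogeneous
  prime `𝔮 ⊇ (Q)`, `P ∈ 𝔮`, of rank `2`, `deg 𝔮 ≤ ab ≤ 2Δ²`,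
  `h(𝔮) ≤ b h((Q)) + a h(P) + 21ab ≤ 400 ΔY` (`arith_height`), and
  `log |𝔮(ω̄)| ≤ −(U/2T₀)(Δ h(𝔮) + Y deg 𝔮)` with `T₀ = Δ (b h((Q)) + a h(P) + 21ab) + Y ab ≤ 60 Δ X`,
  `U = Δ² X/(2c₁)` (`X = Δ h((Q)) + Δ a + Y a`), whence the rate `U/2T₀ ≥ Δ/(240 c₁) ≥ Δ/c` for
  `c = 1000 (c₁ + c_B)` (`arith_rate`).

Proofs only: no definitions, nothing asserted beyond the registered stub and private arithmetic.
Sources: Nesterenko–Philippon (eds.), LNM 1752 (2001), Ch. 3 §4 (Prop. 4.7, 4.11, pp. 39–41);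
Philippon, Publ. Math. IHÉS 64 (1986) §3 (the weighted choice); Philippon, J. Number Theory 81 (2000)
(AP1 in `ℙⁿ`).
-/

set_option linter.dupNamespace false

noncomputable section

namespace Summit.Schanuel.Schanuel.Cruxes.ApproximationProperty.OrbitInterpolationDeterminant

open Literature.NumberTheory.Transcendental Literature.NumberTheory.Transcendental.Nesterenko
open Literature.NumberTheory.Transcendental.PhilipponMain MvPolynomial Real Module
open scoped BigOperators

attribute [local instance] MvPolynomial.gradedAlgebra

namespace SmallPrimeCurve3

/-! ## The count of monomials modulo a surface -/

/-- `2 binom(d+3,3) + a (d+3)(d+2) ≤ 2 binom(a+d+3,3)`: each of the `a` slices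
`binom(j+2,2)`, `d < j ≤ a + d`, of `binom(a+d+3,3) − binom(d+3,3)` is at least `binom(d+3,2)`.
[folklore] -/
theorem choose_gap (d : ℕ) : ∀ a : ℕ,
    2 * (d + 3).choose d + a * ((d + 3) * (d + 2)) ≤ 2 * (a + d + 3).choose (a + d)
  | 0 => by simp
  | a + 1 => by
    have ih := choose_gap d a
    have h1 : (a + 1 + d + 3).choose (a + 1 + d) =
        (a + d + 3).choose (a + d) + (a + d + 3).choose (a + d + 1) := by
      rw [show a + 1 + d + 3 = (a + d + 3) + 1 by ring, show a + 1 + d = (a + d) + 1 by ring]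
      exact Nat.choose_succ_succ' _ _
    have h2 := BoxModCurve.two_mul_choose_two (a + d + 1)
    rw [show a + d + 1 + 2 = a + d + 3 by ring] at h2
    have h3 : (d + 3) * (d + 2) ≤ (a + d + 3) * (a + d + 1 + 1) :=
      Nat.mul_le_mul (by omega) (by omega)
    rw [h1]
    nlinarith [ih, h2, h3]

/-- The count of degree-`b` monomials modulo a form of degree `a ≤ D`, `b = 2D`, `D = ⌊Δ⌋`:
`binom(b+3,3) − binom(b−a+3,3) ≥ a Δ²/2 + 4`. [folklore] -/
theorem count_bound {a D b : ℕ} (ha : 1 ≤ a) (haD : a ≤ D) (hD : 1 ≤ D) (hb : b = 2 * D) {Δ : ℝ}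
    (hΔ0 : 0 ≤ Δ) (hΔD : Δ ≤ D + 1) :
    (a : ℝ) * Δ ^ 2 / 4 ≤
      ((((b + 3).choose b - (b - a + 3).choose (b - a) : ℕ) : ℝ) - 4) / 2 := by
  obtain ⟨d, rfl⟩ : ∃ d, b = a + d := ⟨b - a, by omega⟩
  rw [Nat.add_sub_cancel_left]
  have h1 := choose_gap d a
  have hdD : D ≤ d := by omega
  have h2 : a * ((D + 3) * (D + 2)) ≤ a * ((d + 3) * (d + 2)) :=
    Nat.mul_le_mul_left _ (Nat.mul_le_mul (by omega) (by omega))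
  have h4 : a * ((D + 3) * (D + 2)) ≤
      2 * ((a + d + 3).choose (a + d) - (d + 3).choose d) := by omega
  have h5 : (a : ℝ) * ((D + 3) * (D + 2)) ≤
      2 * (((a + d + 3).choose (a + d) - (d + 3).choose d : ℕ) : ℝ) := by
    exact_mod_cast h4
  have haR : (1 : ℝ) ≤ a := by exact_mod_cast ha
  have hDR : (1 : ℝ) ≤ D := by exact_mod_cast hD
  have h6 : Δ ^ 2 ≤ ((D : ℝ) + 1) ^ 2 := pow_le_pow_left₀ hΔ0 hΔD 2
  have h7 : (a : ℝ) * Δ ^ 2 ≤ a * ((D : ℝ) + 1) ^ 2 := mul_le_mul_of_nonneg_left h6 (by linarith)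
  nlinarith [h5, h7]

/-! ## Real arithmetic of the two cuts -/

/-- The cost of the cut is half the smallness of the surface: with `q = Δ²/(2c₁) ≥ 500`,
`h(P) a + h₁ b + 99ab + 54ab ≤ q (Δ h₁ + Δ a + Y a)`. [folklore] -/
theorem arith_E {c c₁ Δ Y a b h₁ hP : ℝ} (hc₁ : 1 ≤ c₁) (hc : 1000 * c₁ ≤ c) (hcΔ : c ≤ Δ)
    (hΔY : Δ ≤ Y) (ha : 1 ≤ a) (hb : b ≤ 2 * Δ) (hh₁ : 0 ≤ h₁)
    (hPa : hP * a ≤ 16 * (a * Y + Δ * h₁)) :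
    hP * a + h₁ * b + 99 * a * b + 54 * (a * b) ≤
      Δ ^ 2 / c₁ * (Δ * (h₁ + a) + Y * a) / 2 := by
  have hc₁0 : 0 < c₁ := by linarith
  have hΔ1 : 1 ≤ Δ := by nlinarith
  have hΔ0 : 0 ≤ Δ := by linarith
  have ha0 : 0 ≤ a := by linarith
  have hY0 : 0 ≤ Y := by linarith
  -- `q = Δ²/(2c₁) ≥ 500`
  set q : ℝ := Δ ^ 2 / c₁ / 2 with hq
  have hq500 : 500 ≤ q := by
    rw [hq, le_div_iff₀ (by norm_num : (0:ℝ) < 2), le_div_iff₀ hc₁0]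
    nlinarith
  have e : Δ ^ 2 / c₁ * (Δ * (h₁ + a) + Y * a) / 2 = q * (Δ * h₁) + q * (Δ * a) + q * (Y * a) := by
    rw [hq]; ring
  rw [e]
  have t1 : h₁ * b ≤ 2 * (Δ * h₁) := by nlinarith [mul_le_mul_of_nonneg_left hb hh₁]
  have t2 : 99 * a * b + 54 * (a * b) ≤ 306 * (Δ * a) := by
    nlinarith [mul_le_mul_of_nonneg_left hb ha0]
  have u1 : 18 * (Δ * h₁) ≤ q * (Δ * h₁) := mul_le_mul_of_nonneg_right (by linarith) (by positivity)
  have u2 : 306 * (Δ * a) ≤ q * (Δ * a) := mul_le_mul_of_nonneg_right (by linarith) (by positivity)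
  have u3 : 16 * (Y * a) ≤ q * (Y * a) := mul_le_mul_of_nonneg_right (by linarith) (by positivity)
  nlinarith

/-- The box beats the target: `c_B b + S₁ ≤ (aΔ²/4) h₂` for the adaptive height
`a h₂ = 16 (aY + Δ h₁)`. [folklore] -/
theorem arith_box {c c₁ cB Δ Y a b h₁ h₂ : ℝ} (hc₁ : 1 ≤ c₁) (hcB : 0 < cB) (hc : 1000 * cB ≤ c)
    (hc' : 1000 ≤ c) (hcΔ : c ≤ Δ) (hΔY : Δ ≤ Y) (ha : 1 ≤ a) (hb : b ≤ 2 * Δ) (hh₁ : 0 ≤ h₁)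
    (hh₂ : 16 * (a * Y + Δ * h₁) ≤ a * h₂) :
    cB * b + Δ ^ 2 / c₁ * (Δ * (h₁ + a) + Y * a) ≤ a * Δ ^ 2 / 4 * h₂ := by
  have hc₁0 : 0 < c₁ := by linarith
  have hΔ0 : 0 < Δ := by linarith
  have hY1 : 1 ≤ Y := by linarith
  have ha0 : 0 ≤ a := by linarith
  have hX0 : 0 ≤ Δ * (h₁ + a) + Y * a := by positivity
  -- `S₁ ≤ Δ² X`
  have h1 : Δ ^ 2 / c₁ * (Δ * (h₁ + a) + Y * a) ≤ Δ ^ 2 * (Δ * (h₁ + a) + Y * a) := by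
    refine mul_le_mul_of_nonneg_right ?_ hX0
    rw [div_le_iff₀ hc₁0]
    nlinarith [sq_nonneg Δ]
  -- `(aΔ²/4) h₂ = (Δ²/4)(a h₂) ≥ 4Δ²(aY + Δh₁)`
  have h2 : 4 * Δ ^ 2 * (a * Y + Δ * h₁) ≤ a * Δ ^ 2 / 4 * h₂ := by
    have e : a * Δ ^ 2 / 4 * h₂ = Δ ^ 2 / 4 * (a * h₂) := by ring
    rw [e]
    nlinarith [mul_le_mul_of_nonneg_left hh₂ (by positivity : (0:ℝ) ≤ Δ ^ 2 / 4)]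
  -- `cB b ≤ 2 cB Δ ≤ Δ² ≤ aΔ²Y`
  have h3 : cB * b ≤ Δ ^ 2 * (Y * a) := by
    have e1 : cB * b ≤ cB * (2 * Δ) := mul_le_mul_of_nonneg_left hb hcB.le
    have e2 : cB * (2 * Δ) ≤ Δ * Δ := by nlinarith
    have e3 : Δ * Δ ≤ Δ ^ 2 * (Y * a) := by
      rw [sq]; exact le_mul_of_one_le_right (by positivity) (by nlinarith)
    linarith
  have h4 : Δ ^ 2 * (Δ * a) ≤ Δ ^ 2 * (Y * a) :=
    mul_le_mul_of_nonneg_left (mul_le_mul_of_nonneg_right hΔY ha0) (by positivity)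
  have h5 : 0 ≤ Δ ^ 2 * (Y * a) := by positivity
  have h6 : 0 ≤ Δ ^ 2 * (Δ * h₁) := by positivity
  have e : Δ ^ 2 * (Δ * (h₁ + a) + Y * a) = Δ ^ 2 * (Δ * h₁) + Δ ^ 2 * (Δ * a) + Δ ^ 2 * (Y * a) := by
    ring
  have e2 : 4 * Δ ^ 2 * (a * Y + Δ * h₁) = 4 * (Δ ^ 2 * (Y * a)) + 4 * (Δ ^ 2 * (Δ * h₁)) := by ring
  rw [e] at h1
  rw [e2] at h2
  linarith [h1, h2, h3, h4]

/-- The height budget of the curve: `h₁ b + h(P) a + 21ab ≤ 400 ΔY ≤ c Δ Y`. [folklore] -/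
theorem arith_height {c Δ Y a b h₁ hP : ℝ} (hc : 1000 ≤ c) (hcΔ : c ≤ Δ) (hΔY : Δ ≤ Y)
    (ha : 1 ≤ a) (haΔ : a ≤ Δ) (hb : b ≤ 2 * Δ) (hb0 : 0 ≤ b) (hh₁Y : h₁ ≤ 19 * Y)
    (hPa : hP * a ≤ 16 * (a * Y + Δ * h₁)) :
    h₁ * b + hP * a + 21 * a * b ≤ c * Δ * Y := by
  have hΔ0 : 0 ≤ Δ := by linarith
  have hY0 : 0 ≤ Y := by linarith
  have ha0 : 0 ≤ a := by linarith
  have t1 : h₁ * b ≤ 38 * (Δ * Y) := by nlinarith [mul_le_mul hh₁Y hb hb0 (by positivity)]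
  have t2 : a * Y ≤ Δ * Y := mul_le_mul_of_nonneg_right haΔ hY0
  have t3 : Δ * h₁ ≤ Δ * (19 * Y) := mul_le_mul_of_nonneg_left hh₁Y hΔ0
  have t4 : a * b ≤ Δ * (2 * Δ) := mul_le_mul haΔ hb hb0 hΔ0
  have t5 : Δ * Δ ≤ Δ * Y := mul_le_mul_of_nonneg_left hΔY hΔ0
  have t6 : 400 * (Δ * Y) ≤ c * (Δ * Y) := mul_le_mul_of_nonneg_right (by linarith) (by positivity)
  nlinarith

/-- The rate of the curve: `Δ/c ≤ U/(2T₀)` with `U = S₁/2`,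
`T₀ = Δ (h₁ b + h(P) a + 21ab) + Y ab ≤ 60 Δ (Δ h₁ + Δ a + Y a)`. [folklore] -/
theorem arith_rate {c c₁ Δ Y a b h₁ hP : ℝ} (hc₁ : 1 ≤ c₁) (hc : 1000 * c₁ ≤ c) (hcΔ : c ≤ Δ)
    (hΔY : Δ ≤ Y) (ha : 1 ≤ a) (hb : b ≤ 2 * Δ) (hb1 : 1 ≤ b) (hh₁ : 0 ≤ h₁) (hP0 : 0 ≤ hP)
    (hPa : hP * a ≤ 16 * (a * Y + Δ * h₁)) :
    Δ / c ≤ Δ ^ 2 / c₁ * (Δ * (h₁ + a) + Y * a) / 2 /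
      (2 * (Δ * (h₁ * b + hP * a + 21 * a * b) + Y * (a * b))) := by
  have hc₁0 : 0 < c₁ := by linarith
  have hc0 : 0 < c := by nlinarith
  have hΔ0 : 0 < Δ := by linarith
  have hY0 : 0 < Y := by linarith
  have ha0 : 0 < a := by linarith
  have hb0 : 0 < b := by linarith
  have hT : 0 < 2 * (Δ * (h₁ * b + hP * a + 21 * a * b) + Y * (a * b)) := by positivity
  rw [div_le_div_iff₀ hc0 hT]
  -- `2 Δ T₀ ≤ 36 Δ³ h₁ + 36 aΔ²Y + 84 aΔ³`
  have t1 : Δ * (2 * (Δ * (h₁ * b + hP * a + 21 * a * b) + Y * (a * b))) ≤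
      36 * (Δ ^ 2 * (Δ * h₁)) + 36 * (Δ ^ 2 * (Y * a)) + 84 * (Δ ^ 2 * (Δ * a)) := by
    have e1 : h₁ * b ≤ 2 * (Δ * h₁) := by nlinarith [mul_le_mul_of_nonneg_left hb hh₁]
    have e2 : a * b ≤ 2 * (Δ * a) := by nlinarith [mul_le_mul_of_nonneg_left hb ha0.le]
    have e3 : Y * (a * b) ≤ 2 * (Δ * (Y * a)) := by nlinarith [mul_le_mul_of_nonneg_left e2 hY0.le]
    have e4 : Δ * (h₁ * b + hP * a + 21 * a * b) ≤
        Δ * (2 * (Δ * h₁) + 16 * (a * Y + Δ * h₁) + 42 * (Δ * a)) :=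
      mul_le_mul_of_nonneg_left (by linarith) hΔ0.le
    nlinarith [e3, e4]
  -- `(S₁/2) c ≥ 500 Δ² X`... with `c/(2c₁) ≥ 500`
  have t2 : 500 * (Δ ^ 2 * (Δ * (h₁ + a) + Y * a)) ≤
      Δ ^ 2 / c₁ * (Δ * (h₁ + a) + Y * a) / 2 * c := by
    have e : Δ ^ 2 / c₁ * (Δ * (h₁ + a) + Y * a) / 2 * c =
        (c / c₁ / 2) * (Δ ^ 2 * (Δ * (h₁ + a) + Y * a)) := by ring
    rw [e]
    refine mul_le_mul_of_nonneg_right ?_ (by positivity)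
    rw [le_div_iff₀ (by norm_num : (0:ℝ) < 2), le_div_iff₀ hc₁0]
    linarith
  have hΔY' : Δ ^ 2 * (Δ * a) ≤ Δ ^ 2 * (Y * a) :=
    mul_le_mul_of_nonneg_left (mul_le_mul_of_nonneg_right hΔY ha0.le) (by positivity)
  have hpos1 : 0 ≤ Δ ^ 2 * (Δ * h₁) := by positivity
  have hpos2 : 0 ≤ Δ ^ 2 * (Δ * a) := by positivity
  nlinarith [t1, t2, hΔY']

/-! ## The box principle modulo a surface of `ℙ³` -/

/-- The box principle modulo the surface `(Q) ⊂ ℙ³` (`RelativeBox.boxModHypersurface_exp`, `m = 3`):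
constant `c_B = 6 + log max(1, ‖ω‖)`. [folklore] -/
theorem box3 (ω : Fin 3 → ℂ) : ∃ cB : ℝ, 0 < cB ∧ ∀ (Q : Rx 3) (a b N : ℕ), Q.IsHomogeneous a →
    Q ≠ 0 → 1 ≤ a → a ≤ b → 1 ≤ N →
    ∃ R : Rx 3, R ∉ Ideal.span {Q} ∧ R.IsHomogeneous b ∧ 1 ≤ maxNorm R ∧ height R ≤ Real.log N ∧
      ‖aeval (Fin.cons 1 ω : Fin (3 + 1) → ℂ) R‖ ≤
        Real.exp (cB * b - ((((b + 3).choose b - (b - a + 3).choose (b - a) : ℕ) : ℝ) - 4) / 2 *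
          Real.log ((N : ℝ) + 1)) := by
  refine ⟨(3 : ℕ) + 3 + Real.log (max 1 ‖ω‖), ?_, fun Q a b N hQ hQ0 ha hab hN => ?_⟩
  · have := Real.log_nonneg (le_max_left (1 : ℝ) ‖ω‖)
    positivity
  · obtain ⟨R, h1, h2, h3, -, h5, h6⟩ :=
      RelativeBox.boxModHypersurface_exp (m := 3) (by norm_num) ω hQ hQ0 ha hab hN
    exact ⟨R, h1, h2, h3, h5, h6⟩

/-! ## The two cuts -/

/-- **Cuts 1–2 of the clause-free `t = 3` descent** (curried form of the stub): from the small prime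
surface `(Q)` of hypothesis H1 (`m = 3`), the box modulo `(Q)` in degree `b = 2⌊Δ⌋` with the adaptive
height `h₂ = 16 (Y + Δ h((Q))/a)` gives `P ∉ (Q)`, and one step of the descent
(`small_prime_of_cut`, `m = r = 3`, weights `Δ, Y`) selects a small prime curve `𝔮 ⊇ (Q, P)`.
[cite: NesterenkoPhilippon2001, Ch. 3 Prop. 4.7, Prop. 4.11 (pp. 39–41)] -/
theorem smallPrimeCurve3
    (hH1 : ∀ (m : ℕ) (ω : Fin m → ℂ), 1 ≤ m → ∃ c : ℝ, 1 ≤ c ∧ ∀ Δ Y : ℝ, c ≤ Δ → Δ ≤ Y →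
      ∃ (Q : Rx m) (a : ℕ), Q ≠ 0 ∧ Q.IsHomogeneous a ∧ 1 ≤ a ∧ (a : ℝ) ≤ Δ ∧
        (Ideal.span {Q}).IsPrime ∧ ideg (Ideal.span {Q}) m = a ∧
        iheight (Ideal.span {Q}) m ≤ (2 * (m : ℝ) ^ 2 + 1) * Y ∧
        iabs (Ideal.span {Q}) m (Fin.cons 1 ω) ≤
          Real.exp (-(Δ ^ (m - 1) / c * (Δ * (iheight (Ideal.span {Q}) m + a) + Y * a))))
    (ω : Fin 3 → ℂ) :
    ∃ c : ℝ, 1 ≤ c ∧ ∀ Δ Y : ℝ, c ≤ Δ → Δ ≤ Y →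
      ∃ (Q : Rx 3) (a : ℕ) (P : Rx 3) (b : ℕ) (𝔮 : Ideal (Rx 3)), Q ≠ 0 ∧ Q.IsHomogeneous a ∧
        1 ≤ a ∧ (a : ℝ) ≤ Δ ∧ (Ideal.span {Q}).IsPrime ∧ P.IsHomogeneous b ∧ 1 ≤ b ∧
        (b : ℝ) ≤ 2 * Δ ∧ P ∉ Ideal.span {Q} ∧ 𝔮.IsPrime ∧
        𝔮.IsHomogeneous (homogeneousSubmodule (Fin (3 + 1)) ℚ) ∧ IsUnmixedOfRank 𝔮 2 ∧ Q ∈ 𝔮 ∧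
        P ∈ 𝔮 ∧ (ideg 𝔮 2 : ℝ) ≤ 2 * Δ ^ 2 ∧ iheight 𝔮 2 ≤ c * Δ * Y ∧
        iabs 𝔮 2 (Fin.cons 1 ω) ≤ Real.exp (-(Δ / c * (Δ * iheight 𝔮 2 + Y * ideg 𝔮 2))) := by
  obtain ⟨c₁, hc₁, hB⟩ := hH1 3 ω (by norm_num)
  obtain ⟨cB, hcB, hbox⟩ := box3 ω
  set ω₁ : Fin (3 + 1) → ℂ := Fin.cons 1 ω with hω₁def
  have hω₁ : ω₁ ≠ 0 := PhilipponMain.cons_one_ne_zero ω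
  have hΘ : 1 ≤ ‖ω₁‖ := PhilipponMain.one_le_norm_cons_one ω
  -- the constant
  set c : ℝ := 1000 * (c₁ + cB) with hcdef
  have hcc₁ : 1000 * c₁ ≤ c := by rw [hcdef]; nlinarith
  have hccB : 1000 * cB ≤ c := by rw [hcdef]; nlinarith
  have hc1000 : 1000 ≤ c := by nlinarith
  have hc1 : 1 ≤ c := by linarith
  refine ⟨c, hc1, fun Δ Y hΔ hY => ?_⟩
  have hΔ0 : 0 < Δ := by linarith
  have hY0 : 0 ≤ Y := by linarith
  -- CUT 1: the small prime surface `𝔭 = (Q)` of hypothesis H1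
  obtain ⟨Q, a, hQ0, hQhom, ha1, haΔ, hQprime, hdegQ, hhQ, habsQ⟩ := hB Δ Y (by linarith) hY
  set 𝔭 : Ideal (Rx 3) := Ideal.span {Q} with h𝔭def
  set h₁ : ℝ := iheight 𝔭 3 with hh₁def
  have hh₁0 : 0 ≤ h₁ := height_nonneg _
  have hh₁Y : h₁ ≤ 19 * Y := hhQ.trans (le_of_eq (by norm_num))
  have ha1R : (1 : ℝ) ≤ a := by exact_mod_cast ha1
  have ha0R : (0 : ℝ) < a := by linarith
  set S₁ : ℝ := Δ ^ 2 / c₁ * (Δ * (h₁ + a) + Y * a) with hS₁def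
  -- the degree `b = 2⌊Δ⌋` of the second form
  set D : ℕ := ⌊Δ⌋₊ with hDdef
  have haD : a ≤ D := Nat.le_floor haΔ
  have hD1 : 1 ≤ D := ha1.trans haD
  have hDΔ : (D : ℝ) ≤ Δ := Nat.floor_le hΔ0.le
  have hΔD : Δ ≤ D + 1 := (Nat.lt_floor_add_one Δ).le
  set b : ℕ := 2 * D with hbdef
  have hab : a ≤ b := by omega
  have hb1 : 1 ≤ b := by omega
  have hbR : (b : ℝ) = 2 * D := by rw [hbdef]; push_cast; ring
  have hb2Δ : (b : ℝ) ≤ 2 * Δ := by rw [hbR]; linarith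
  have hb0R : (0 : ℝ) ≤ b := Nat.cast_nonneg _
  have hb1R : (1 : ℝ) ≤ b := by exact_mod_cast hb1
  -- the adaptive height `h₂` and the box height `N = ⌊e^{h₂}⌋`
  set h₂ : ℝ := 16 * (Y + Δ * h₁ / a) with hh₂def
  have hh₂0 : 0 ≤ h₂ := by positivity
  have hah₂ : a * h₂ = 16 * (a * Y + Δ * h₁) := by
    rw [hh₂def]
    field_simp
  obtain ⟨hN1, hlogN, hlogN1⟩ := CycleAPITwo.box_facts hh₂0
  set N : ℕ := ⌊exp h₂⌋₊ with hNdef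
  -- CUT 2: the second small form `P ∉ (Q)` from the box modulo the surface
  obtain ⟨P, hPQ, hPhom, hP1, hhP, hPval⟩ := hbox Q a b N hQhom hQ0 ha1 hab hN1
  set hP : ℝ := height P with hhPdef
  have hhP0 : 0 ≤ hP := height_nonneg _
  have hPh₂ : hP ≤ h₂ := hhP.trans hlogN
  have hPa : hP * a ≤ 16 * (a * Y + Δ * h₁) := by
    rw [← hah₂, mul_comm]
    exact mul_le_mul_of_nonneg_left hPh₂ ha0R.le
  have hM := count_bound ha1 haD hD1 hbdef hΔ0.le hΔD
  have hnormP : normAt ω₁ P ≤ exp (cB * b - a * Δ ^ 2 / 4 * h₂) := by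
    have h1 : normAt ω₁ P ≤ ‖aeval ω₁ P‖ := by
      rw [normAt]
      exact div_le_self (norm_nonneg _) (one_le_mul_of_one_le_of_one_le hP1 (one_le_pow₀ hΘ))
    refine h1.trans (hPval.trans (exp_le_exp.mpr ?_))
    have h0 : (0 : ℝ) ≤ a * Δ ^ 2 / 4 := by positivity
    have h2 := mul_le_mul hM hlogN1 hh₂0 (by linarith)
    linarith
  -- the smallness budget of the cut
  have hA := arith_E hc₁ hcc₁ hΔ hY ha1R hb2Δ hh₁0 hPa
  have hBx := arith_box hc₁ hcB hccB hc1000 hΔ hY ha1R hb2Δ hh₁0 hah₂.symm.le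
  obtain ⟨U, hUdef⟩ : ∃ U : ℝ, U = S₁ / 2 := ⟨_, rfl⟩
  have hsmall : max (normAt ω₁ P) (iabs 𝔭 3 ω₁) * exp (hP * a + h₁ * b + 99 * a * b) ≤ exp (-U) := by
    have h54 : 0 ≤ 54 * ((a : ℝ) * b) := by positivity
    refine CycleAPITwo.max_mul_exp_le hnormP habsQ ?_ ?_
    · rw [hUdef, hS₁def]
      linarith only [hA, hBx, h54]
    · rw [hUdef, hS₁def]
      linarith only [hA, h54]
  have hU54 : 2 * ((3 : ℕ) : ℝ) ^ 3 * ((a : ℝ) * b) ≤ U := by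
    rw [hUdef, hS₁def]
    have : 0 ≤ hP * a + h₁ * b + 99 * a * b := by positivity
    push_cast
    linarith only [hA, this]
  have hE : height P * (ideg 𝔭 3 : ℝ) + iheight 𝔭 3 * b + 11 * ((3 : ℕ) : ℝ) ^ 2 * (ideg 𝔭 3) * b =
      hP * a + h₁ * b + 99 * a * b := by
    rw [hdegQ, ← hh₁def, ← hhPdef]
    push_cast
    ring
  -- THE CUT: `small_prime_of_cut` with `m = r = 3`, weights `Δ, Y`
  have hQu : ¬ IsUnit Q := fun hu => hQprime.ne_top (Ideal.span_singleton_eq_top.mpr hu)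
  have hunm : IsUnmixedOfRank 𝔭 3 := PhilipponMain.isUnmixedOfRank_span_singleton hQ0 hQu
  have h𝔭hom : 𝔭.IsHomogeneous (homogeneousSubmodule (Fin (3 + 1)) ℚ) := by
    refine Ideal.homogeneous_span _ _ fun x hx => ?_
    rw [Set.mem_singleton_iff] at hx
    subst hx
    exact ⟨a, hQhom⟩
  have hdegR : (ideg 𝔭 3 : ℝ) * b = a * b := by rw [hdegQ]
  obtain ⟨𝔮, h𝔮prime, h𝔮hom, h𝔮unm, h𝔭𝔮, hP𝔮, h𝔮deg, h𝔮h, h𝔮abs⟩ :=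
    small_prime_of_cut 3 3 𝔭 P b ω₁ Δ Y U (by norm_num) le_rfl hQprime h𝔭hom hunm hPhom hb1 hPQ
      hω₁ hΔ0.le hY0 (by linarith only [hΔ0, hY0]) (by rw [hE]; exact hsmall)
      (by rw [hdegR]; exact hU54)
  simp only [show (3 : ℕ) - 1 = 2 from rfl, hdegQ] at h𝔮unm h𝔮deg h𝔮h h𝔮abs
  rw [← hh₁def, ← hhPdef] at h𝔮h h𝔮abs
  -- the a-priori weight `T₀` of the cut
  set T₀ : ℝ := Δ * (h₁ * b + hP * a + 21 * a * b) + Y * (a * b) with hT₀def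
  have h21 : ((3 : ℕ) : ℝ) * ((3 : ℕ) + 1) + ((3 : ℕ) : ℝ) ^ 2 = 21 := by norm_num
  rw [h21] at h𝔮h h𝔮abs
  have hHt := arith_height hc1000 hΔ hY ha1R haΔ hb2Δ hb0R hh₁Y hPa
  have hrate := arith_rate hc₁ hcc₁ hΔ hY ha1R hb2Δ hb1R hh₁0 hhP0 hPa
  rw [← hT₀def] at hrate
  refine ⟨Q, a, P, b, 𝔮, hQ0, hQhom, ha1, haΔ, hQprime, hPhom, hb1, hb2Δ, hPQ, h𝔮prime, h𝔮hom,
    h𝔮unm, h𝔭𝔮 (Ideal.mem_span_singleton_self Q), hP𝔮, ?_, h𝔮h.trans hHt, ?_⟩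
  · -- degree `deg 𝔮 ≤ ab ≤ 2Δ²`
    have h1 : (ideg 𝔮 2 : ℝ) ≤ a * b := by exact_mod_cast h𝔮deg
    have h2 : (a : ℝ) * b ≤ Δ * (2 * Δ) := mul_le_mul haΔ hb2Δ hb0R hΔ0.le
    exact h1.trans (h2.trans (le_of_eq (by ring)))
  · -- accuracy: the rate `U/(2T₀) ≥ Δ/c`
    refine h𝔮abs.trans ?_
    have hW : 0 ≤ Δ * iheight 𝔮 2 + Y * ideg 𝔮 2 :=
      add_nonneg (mul_nonneg hΔ0.le (height_nonneg _)) (mul_nonneg hY0 (Nat.cast_nonneg _))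
    rw [exp_le_exp, ← hT₀def, neg_mul, neg_le_neg_iff, hUdef, hS₁def]
    exact mul_le_mul_of_nonneg_right hrate hW

end SmallPrimeCurve3

/-! ## The registered stub -/

/-- **Registered stub `smallPrimeCurve3_of`** (crux `stmt-Schanuel-6117`, line
`orbit-interpolation-determinant`): cuts 1–2 of the clause-free `t = 3` descent at `ω̄ = (1 : ω) ∈ ℂ⁴`.
Assuming the small prime hypersurface statement (H1, the neighbouring stub `small_prime_hypersurface`,
used at `m = 3`), for `Y ≥ Δ ≥ c(ω)` there are a prime principal ideal `(Q)`, `Q` a form of degree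
`a ≤ Δ`, a form `P ∉ (Q)` of degree `b = 2⌊Δ⌋ ≤ 2Δ` (box principle modulo `(Q)` with the adaptive
height `h₂ = 16 (Y + Δ h((Q))/a)`), and a homogeneous prime `𝔮 ∋ Q, P` of rank `2` (a space curve) with
`deg 𝔮 ≤ 2Δ²`, `h(𝔮) ≤ c Δ Y` and `log |𝔮(ω̄)| ≤ −(Δ/c)(Δ h(𝔮) + Y deg 𝔮)` — one step of the descent
(LNM 1752 Ch. 3 Prop. 4.11 + Prop. 4.7 with Philippon's weighted choice of a component).
[cite: NesterenkoPhilippon2001, Ch. 3 Prop. 4.7, Prop. 4.11 (pp. 39–41)] -/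
theorem smallPrimeCurve3_of : (∀ (m : ℕ) (ω : Fin m → ℂ), 1 ≤ m → ∃ c : ℝ, 1 ≤ c ∧ ∀ Δ Y : ℝ, c ≤ Δ → Δ ≤ Y → ∃ (Q : Rx m) (a : ℕ), Q ≠ 0 ∧ Q.IsHomogeneous a ∧ 1 ≤ a ∧ (a : ℝ) ≤ Δ ∧ (Ideal.span {Q}).IsPrime ∧ ideg (Ideal.span {Q}) m = a ∧ iheight (Ideal.span {Q}) m ≤ (2 * (m : ℝ) ^ 2 + 1) * Y ∧ iabs (Ideal.span {Q}) m (Fin.cons 1 ω) ≤ Real.exp (-(Δ ^ (m - 1) / c * (Δ * (iheight (Ideal.span {Q}) m + a) + Y * a)))) → ∀ ω : Fin 3 → ℂ, ∃ c : ℝ, 1 ≤ c ∧ ∀ Δ Y : ℝ, c ≤ Δ → Δ ≤ Y → ∃ (Q : Rx 3) (a : ℕ) (P : Rx 3) (b : ℕ) (𝔮 : Ideal (Rx 3)), Q ≠ 0 ∧ Q.IsHomogeneous a ∧ 1 ≤ a ∧ (a : ℝ) ≤ Δ ∧ (Ideal.span {Q}).IsPrime ∧ P.IsHomogeneous b ∧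 1 ≤ b ∧ (b : ℝ) ≤ 2 * Δ ∧ P ∉ Ideal.span {Q} ∧ 𝔮.IsPrime ∧ 𝔮.IsHomogeneous (homogeneousSubmodule (Fin (3 + 1)) ℚ) ∧ IsUnmixedOfRank 𝔮 2 ∧ Q ∈ 𝔮 ∧ P ∈ 𝔮 ∧ (ideg 𝔮 2 : ℝ) ≤ 2 * Δ ^ 2 ∧ iheight 𝔮 2 ≤ c * Δ * Y ∧ iabs 𝔮 2 (Fin.cons 1 ω) ≤ Real.exp (-(Δ / c * (Δ * iheight 𝔮 2 + Y * ideg 𝔮 2))) := by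
  intro hH1 ω
  exact SmallPrimeCurve3.smallPrimeCurve3 hH1 ω

end Summit.Schanuel.Schanuel.Cruxes.ApproximationProperty.OrbitInterpolationDeterminant

end
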